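import Summits.CriticalPhenomena.Ising3DConformalLimit.Theses.EnergyNotSigmaSquared
import Summits.CriticalPhenomena.Ising3DConformalLimit.Theses.HyperoctahedralRP
import Summits.CriticalPhenomena.Ising3DConformalLimit.Theorems.EnergyNotSigmaSquaredMoebiusLimitExistsHrpFactorisation
import Summits.CriticalPhenomena.Ising3DConformalLimit.Theorems.HyperoctahedralRPLimitRotationInvariant
import HarnessLib

/-!
# Split of crux `EnergyNotSigmaSquared.MoebiusLimit` (item stmt-CriticalPhenomena-1344) into TWO leaf sub-cruxes
(crux-strategist decomposition, `--supports stmt-CriticalPhenomena-1344`, 2026-08-17)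

The crux `MoebiusLimit` (verbatim `PerfectScreening.MoebiusLimitExists`; shared by eleven routes) — "the critical
Ising correlators on `ℤ³` have a non-degenerate, Möbius-covariant pointwise scaling limit" — is, by the landed
factorisation `MoebiusLimitExists_iff_hrp` (`…HrpFactorisation.lean`, p114842), EXACTLY the conjunction of the three
`HyperoctahedralRP` cruxes 1981 ∧ 1980 ∧ 1982.  Since 2026-08-16T22:39Z the middle factor, item stmt-1980
`HyperoctahedralRP.LimitRotationInvariant` (`O(3)`-invariance of every normalised scale-covariant translation-invariant
limit, given `HRP2Rigidity`), is a THEOREM of the tree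
(`Cruxes.LimitRotationInvariant.QuarterTurnLiouville.LimitRotationInvariant_of`, p129740, via the multiple-reflection
unit sigma bound of crux stmt-8367).  Hence the crux is now the conjunction of TWO open leaves:

* `Sub₁` = item stmt-CriticalPhenomena-1981 `HyperoctahedralRP.ExistsScaleCovariantLimit` — EXISTENCE: a normalised,
  non-degenerate, translation-invariant, scale-covariant pointwise limit of `criticalCorr 3` exists (no rotations, no
  inversion);
* `Sub₂` = item stmt-CriticalPhenomena-1982 `HyperoctahedralRP.InversionUpgradeNormalised` — INVERSION UPGRADE: every
  normalised, non-degenerate, Euclidean-invariant, scale-covariant pointwise limit of `criticalCorr 3` is inversion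
  covariant.

Main result `MoebiusLimit_of_subs : Sub₁ → Sub₂ → EnergyNotSigmaSquared.MoebiusLimit` (the glue of the split; pure
assembly over the two landed theorems), its `PerfectScreening` spelling, and the sharpened factorisation
`MoebiusLimit_iff_subs : MoebiusLimit ↔ Sub₁ ∧ Sub₂` (each leaf is necessary: `existsScaleCovariantLimit_of_MoebiusLimitExists`,
`inversionUpgradeNormalised_of_MoebiusLimitExists`, both landed in `…HrpFactorisation.lean`).  For the planners of the other
ten routes wanting item 1344: the same two-leaf split applies verbatim (all spellings are one term).

References: H. Duminil-Copin, *100 years of the (critical) Ising model on the hypercubic lattice*, Proc. ICM 2022,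
§8.1 p. 25 (the covariance law) and §8.4 p. 29 (existence and conformal invariance open on `ℤ³`); A. M. Polyakov, JETP
Lett. 12 (1970) 381 (the inversion upgrade); P. Di Francesco, P. Mathieu, D. Sénéchal, *Conformal Field Theory* (1997)
§4.3.1 eq. (4.62) (Möbius = Euclid + dilations + inversion).  No definitions, no `sorry`.
-/

noncomputable section

open Literature.Probability.LatticeModels
open Summit.CriticalPhenomena.Ising3DConformalLimit.Theses

namespace Summit.CriticalPhenomena.Ising3DConformalLimit.MoebiusLimitExistsSplit

/-- **GLUE of the two-leaf split of crux stmt-1344.**  Existence (item 1981) and the inversion upgrade (item 1982)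
give `EnergyNotSigmaSquared.MoebiusLimit`: the middle hypothesis of the landed three-factor assembly
`MoebiusLimitExists_of_hrp` — `O(3)` invariance of every normalised scale-covariant limit, item 1980 — is supplied by
the tree theorem `LimitRotationInvariant_of`. [cite: DuminilCopinICM2022, §8.1 p. 25 and §8.4 p. 29] -/
theorem MoebiusLimit_of_subs
    (h1981 : HyperoctahedralRP.ExistsScaleCovariantLimit)
    (h1982 : HyperoctahedralRP.InversionUpgradeNormalised) :
    EnergyNotSigmaSquared.MoebiusLimit :=
  MoebiusLimitExistsOnlyInteraction.MoebiusLimitExists_of_hrp h1981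
    Cruxes.LimitRotationInvariant.QuarterTurnLiouville.LimitRotationInvariant_of h1982

/-- The same glue for the `PerfectScreening.MoebiusLimitExists` spelling of item stmt-1344 (the crux directory's
name; one term). [cite: DuminilCopinICM2022, §8.4 p. 29] -/
theorem MoebiusLimitExists_of_subs
    (h1981 : HyperoctahedralRP.ExistsScaleCovariantLimit)
    (h1982 : HyperoctahedralRP.InversionUpgradeNormalised) :
    PerfectScreening.MoebiusLimitExists :=
  MoebiusLimit_of_subs h1981 h1982

/-- **`MoebiusLimit ⟺ 1981 ∧ 1982`** — after the proof of item 1980, crux stmt-1344 is EXACTLY the conjunction of the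
two open leaves EXISTENCE (1981) and INVERSION UPGRADE (1982); each is necessary (landed
`existsScaleCovariantLimit_of_MoebiusLimitExists`, `inversionUpgradeNormalised_of_MoebiusLimitExists`).
[cite: DuminilCopinICM2022, §8.4 p. 29] -/
theorem MoebiusLimit_iff_subs :
    EnergyNotSigmaSquared.MoebiusLimit ↔
      HyperoctahedralRP.ExistsScaleCovariantLimit ∧ HyperoctahedralRP.InversionUpgradeNormalised :=
  ⟨fun h => ⟨MoebiusLimitExistsOnlyInteraction.existsScaleCovariantLimit_of_MoebiusLimitExists h,
      MoebiusLimitExistsOnlyInteraction.inversionUpgradeNormalised_of_MoebiusLimitExists h⟩,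
    fun h => MoebiusLimit_of_subs h.1 h.2⟩

/-- The two-leaf factorisation for the `PerfectScreening.MoebiusLimitExists` spelling. [cite: DuminilCopinICM2022, §8.4 p. 29] -/
theorem MoebiusLimitExists_iff_subs :
    PerfectScreening.MoebiusLimitExists ↔
      HyperoctahedralRP.ExistsScaleCovariantLimit ∧ HyperoctahedralRP.InversionUpgradeNormalised :=
  MoebiusLimit_iff_subs

end Summit.CriticalPhenomena.Ising3DConformalLimit.MoebiusLimitExistsSplit

end
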